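import Literature.NumberTheory.LFunctions.ChebyshevSylvesterPsi
import Mathlib.Tactic.NormNum.Prime
import HarnessLib

/-!
# Primes in `(x, 1.15 x]` for every real `x ≥ 33` (explicit Chebyshev–Sylvester windows)

Topic `Literature/NumberTheory/LFunctions`. Pure proof file on top of
`ChebyshevSylvesterPsi.lean` (`0.9392 x − 9 √x ≤ ψ(x) ≤ 1.0722 x + 7 √x`):

* `Literature.NumberTheory.LFunctions.exists_prime_Ioc_sylvester` — **for every real `x ≥ 33` there
  is a prime `p` with `x < p ≤ (23/20) x`** (and `exists_prime_Icc_sylvester`, the same in the shape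
  `∀ x ≥ U, ∃ p, x ≤ p ≤ η x` of prime-window hypotheses);
* `Sylvester.theta_window_ge` — `θ(1.15 x) − θ(x) ≥ x/200` for `x ≥ 10⁸`, and
  `Sylvester.card_primes_window_ge` — at least `x/(200 log(1.15x))` primes in `(x, 1.15x]` for
  `x ≥ 10⁸` (the "`k³` primes in a window" input of Ford's Lemmas 3.2/6.5).

This is the unconditional, fully explicit prime-window input (ratio `η = 1.15` at all scales) that
iterations of Vinogradov's mean value theorem with explicit constants consume (e.g. the hypothesis
`hprime` of `FordVK.ford_lemma67`, Ford 2002, Lemma 6.7, where Ford uses Rosser–Schoenfeld's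
`53/47`-windows); the tree and Mathlib otherwise only have Bertrand's postulate (`η = 2`).
Historically: Chebyshev 1852 obtained `η = 6/5 + ε` for large `x`, Sylvester 1881/1892 `η ≈ 1.092`
for (astronomically) large `x`; explicit thresholds of this kind are due to Schur (1929, `η = 5/4`,
`x ≥ 24`) and Breusch (1932, `η = 9/8`, `x ≥ 48`), by longer computations.

## Proof

Three ranges. (i) `33 ≤ x < 27337`: a chain of `52` primes `37, 41, …, 27337`, each at most `23/20`
times its predecessor (`norm_num` primality, `decide` for the chain condition). (ii)
`24000 ≤ x ≤ 7·10⁶`: the tree's kernel-certified Schoenfeld bound `|θ(y) − y| ≤ √y log² y/(8π)` on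
`[599, 8886113]` (`abs_theta_sub_le_smallRange`) at `y = x` and `y = 1.15 x` gives
`θ(1.15x) − θ(x) ≥ 0.15 x − 21.25 √x > 0`. (iii) `x ≥ 6.25·10⁶`: `θ(1.15 x) − θ(x) ≥
ψ(1.15x) − ψ(x) − (ψ − θ)(1.15x) ≥ 0.00788 x − 17.8 √x − (ψ − θ)(1.15 x) > 0` by the Sylvester
bounds, with `ψ − θ ≤ √y + (4/3) y^{1/3}` below `2³²` (Nicolas, kernel-certified in the tree:
`psi_sub_theta_le_of_lt_two_pow_32`) and Mathlib's `ψ − θ ≤ 2 √y log y` together with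
`log y ≤ 14 + √y/1490` beyond. A positive `θ`-increment on `(x, 1.15x]` means a prime there
(`exists_prime_of_theta_lt`).

## References

* J. J. Sylvester, *On arithmetical series*, Messenger of Math. 21 (1892), 1–19, 87–120. [Sylvester1892]
* P. L. Chebyshev, *Mémoire sur les nombres premiers*, J. Math. Pures Appl. 17 (1852), 366–390
  (§ "postulatum de M. Bertrand", primes in `(x, 6x/5]` for large `x`). [Chebyshev1852]
* T. Gantumur, arXiv:2512.02466 (2025), §§3–6. [Gantumur2025]
-/

noncomputable section

namespace Literature.NumberTheory.LFunctions

namespace Sylvester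

open Nat hiding log
open Finset Real
open scoped Chebyshev

/-! ### A positive increment of `θ` on `(a, b]` produces a prime there -/

/-- `θ(b) − θ(a) = ∑_{a < p ≤ b} log p` for `0 ≤ a ≤ b`. [folklore] -/
theorem theta_sub_theta_eq_sum {a b : ℝ} (hab : a ≤ b) :
    θ b - θ a = ∑ p ∈ (Ioc ⌊a⌋₊ ⌊b⌋₊).filter Nat.Prime, Real.log p := by
  have hfl : ⌊a⌋₊ ≤ ⌊b⌋₊ := Nat.floor_le_floor hab
  rw [Chebyshev.theta, Chebyshev.theta, ← Finset.Ioc_union_Ioc_eq_Ioc (Nat.zero_le _) hfl,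
    Finset.filter_union, Finset.sum_union]
  · ring
  · exact Finset.disjoint_filter_filter ((Finset.Ioc_disjoint_Ioc_of_le le_rfl))

/-- If `θ(a) < θ(b)` (`0 ≤ a ≤ b`) then some prime lies in `(a, b]`. [folklore] -/
theorem exists_prime_of_theta_lt {a b : ℝ} (ha : 0 ≤ a) (hab : a ≤ b) (h : θ a < θ b) :
    ∃ p : ℕ, p.Prime ∧ a < p ∧ (p : ℝ) ≤ b := by
  by_contra hne
  push Not at hne
  have hempty : (Ioc ⌊a⌋₊ ⌊b⌋₊).filter Nat.Prime = ∅ := by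
    apply Finset.eq_empty_of_forall_notMem
    intro p hp
    simp only [Finset.mem_filter, Finset.mem_Ioc] at hp
    have hap : a < p := (Nat.floor_lt ha).1 hp.1.1
    have hpb : (p : ℝ) ≤ b := by
      have := hp.1.2
      rw [Nat.le_floor_iff (ha.trans hab)] at this
      exact this
    exact absurd (hne p hp.2 hap) (not_lt.2 hpb)
  have := theta_sub_theta_eq_sum hab
  rw [hempty, Finset.sum_empty] at this
  linarith

/-! ### Range (i): a chain of primes -/

/-- The chain of primes `37, 41, …, 27337`, each at most `23/20` times its predecessor. [folklore] -/
def chain : List ℕ :=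
  [37, 41, 47, 53, 59, 67, 73, 83, 89, 101, 113, 127, 139, 157, 179, 199, 227, 257, 293, 331, 379,
    433, 491, 563, 647, 743, 853, 977, 1123, 1291, 1483, 1699, 1951, 2243, 2579, 2963, 3407, 3917,
    4493, 5153, 5923, 6803, 7823, 8971, 10313, 11839, 13613, 15649, 17989, 20681, 23773, 27337]

/-- Every member of the chain is prime. [folklore] -/
theorem chain_prime : ∀ p ∈ chain, p.Prime := by
  simp only [chain, List.forall_mem_cons]
  refine ⟨?_, ?_, ?_, ?_, ?_, ?_, ?_, ?_, ?_, ?_, ?_, ?_, ?_, ?_, ?_, ?_, ?_, ?_, ?_, ?_, ?_, ?_, ?_, ?_,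
    ?_, ?_, ?_, ?_, ?_, ?_, ?_, ?_, ?_, ?_, ?_, ?_, ?_, ?_, ?_, ?_, ?_, ?_, ?_, ?_, ?_, ?_, ?_, ?_, ?_,
    ?_, ?_, ?_, List.forall_mem_nil _⟩ <;> norm_num

/-- The chain condition, starting from `33`. [folklore] -/
theorem chain_chain : List.IsChain (fun a b : ℕ => a < b ∧ 20 * b ≤ 23 * a) (33 :: chain) := by
  decide

/-- Generic: a chain `a < b₁ < b₂ < …` with `20 bᵢ₊₁ ≤ 23 bᵢ` gives, for every real
`a ≤ x < last`, a member `p` with `x < p ≤ (23/20) x`. [folklore] -/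
theorem exists_mem_of_chain : ∀ (l : List ℕ) (a : ℕ),
    List.IsChain (fun a b : ℕ => a < b ∧ 20 * b ≤ 23 * a) (a :: l) →
    ∀ x : ℝ, (a : ℝ) ≤ x → x < (l.getLastD a : ℝ) → ∃ p ∈ l, x < p ∧ (20 * p : ℝ) ≤ 23 * x
  | [], a, _, x, hax, hx => by simp at hx; linarith
  | b :: l, a, hc, x, hax, hx => by
    rw [List.isChain_cons_cons] at hc
    obtain ⟨⟨-, hab⟩, hc'⟩ := hc
    rcases lt_or_ge x b with hxb | hxb
    · refine ⟨b, List.mem_cons_self, hxb, ?_⟩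
      have : (20 * b : ℝ) ≤ 23 * a := by exact_mod_cast hab
      linarith
    · rw [List.getLastD_cons] at hx
      obtain ⟨p, hp, h1, h2⟩ := exists_mem_of_chain l b hc' x hxb hx
      exact ⟨p, List.mem_cons_of_mem b hp, h1, h2⟩

/-- Range (i): `33 ≤ x < 27337`. [folklore] -/
theorem window_small {x : ℝ} (hx : 33 ≤ x) (hx' : x < 27337) :
    ∃ p : ℕ, p.Prime ∧ x < p ∧ (p : ℝ) ≤ 23 / 20 * x := by
  obtain ⟨p, hp, h1, h2⟩ := exists_mem_of_chain chain 33 chain_chain x (by exact_mod_cast hx)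
    (by simpa [chain] using hx')
  exact ⟨p, chain_prime p hp, h1, by linarith⟩

/-! ### Range (ii): Schoenfeld's certified table -/

/-- Range (ii): `24000 ≤ x ≤ 7·10⁶`, from `|θ(y) − y| ≤ √y log² y/(8π) ≤ 10.25 √y` at `y = x, 1.15x`.
[folklore] -/
theorem window_mid {x : ℝ} (hx : 24000 ≤ x) (hx' : x ≤ 7000000) :
    ∃ p : ℕ, p.Prime ∧ x < p ∧ (p : ℝ) ≤ 23 / 20 * x := by
  have hx0 : 0 ≤ x := by linarith
  apply exists_prime_of_theta_lt hx0 (by linarith)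
  have h1 := abs_theta_sub_le_smallRange (x := x) (by linarith) (by linarith)
  have h2 := abs_theta_sub_le_smallRange (x := 23 / 20 * x) (by linarith) (by linarith)
  have e1 := schoenfeld_err_le (x := x) (by linarith) (by linarith)
  have e2 := schoenfeld_err_le (x := 23 / 20 * x) (by linarith) (by linarith)
  have s2 : Real.sqrt (23 / 20 * x) ≤ 1.0724 * Real.sqrt x := by
    have := sqrt_div_le (x := x) (r := 20 / 23) (c := 1.0724) hx0 (by norm_num) (by norm_num) (by norm_num)
    rwa [show x / (20 / 23) = 23 / 20 * x by ring] at this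
  have hsq : 154 ≤ Real.sqrt x := by
    rw [show (154 : ℝ) = Real.sqrt (154 ^ 2) by rw [Real.sqrt_sq (by norm_num)]]
    exact Real.sqrt_le_sqrt (by nlinarith)
  have hxx : Real.sqrt x * Real.sqrt x = x := Real.mul_self_sqrt hx0
  have h1' := (abs_le.1 h1).2
  have h2' := (abs_le.1 h2).1
  nlinarith

/-! ### Range (iii): the Sylvester bounds -/

/-- `log y ≤ 14 + √y/1490` (tangent line of `log √y` at `e⁸ > 2980`). [folklore] -/
theorem log_le_sqrt_linear {y : ℝ} (hy : 0 < y) : Real.log y ≤ 14 + Real.sqrt y / 1490 := by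
  have h8 : (2980 : ℝ) ≤ Real.exp 8 := by
    have h1 : Real.exp 8 = Real.exp 1 ^ 8 := by rw [← Real.exp_nat_mul]; norm_num
    rw [h1]
    have h2 := Real.exp_one_gt_d9
    calc (2980 : ℝ) ≤ 2.7182818283 ^ 8 := by norm_num
      _ ≤ Real.exp 1 ^ 8 := pow_le_pow_left₀ (by norm_num) h2.le 8
  have hs : 0 < Real.sqrt y := Real.sqrt_pos.2 hy
  have hpos : 0 < Real.exp 8 := Real.exp_pos 8
  have hlog : Real.log (Real.sqrt y / Real.exp 8) ≤ Real.sqrt y / Real.exp 8 - 1 :=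
    Real.log_le_sub_one_of_pos (by positivity)
  rw [Real.log_div hs.ne' hpos.ne', Real.log_exp, Real.log_sqrt hy.le] at hlog
  have : Real.sqrt y / Real.exp 8 ≤ Real.sqrt y / 2980 := div_le_div_of_nonneg_left hs.le (by norm_num) h8
  linarith

/-- Range (iii): `x ≥ 6.25·10⁶`, from the Sylvester bounds for `ψ` and the `ψ − θ` bounds. [folklore] -/
theorem window_large {x : ℝ} (hx : 6250000 ≤ x) :
    ∃ p : ℕ, p.Prime ∧ x < p ∧ (p : ℝ) ≤ 23 / 20 * x := by
  have hx0 : 0 ≤ x := by linarith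
  apply exists_prime_of_theta_lt hx0 (by linarith)
  set y : ℝ := 23 / 20 * x with hy
  have hy1 : 1 ≤ y := by rw [hy]; linarith
  have hy0 : 0 < y := by linarith
  have hψx := psi_le_sylvester hx0
  have hψy := sylvester_le_psi (x := y) hy0.le
  have hθx := Chebyshev.theta_le_psi x
  have s2 : Real.sqrt y ≤ 1.0724 * Real.sqrt x := by
    have := sqrt_div_le (x := x) (r := 20 / 23) (c := 1.0724) hx0 (by norm_num) (by norm_num) (by norm_num)
    rwa [show x / (20 / 23) = 23 / 20 * x by ring] at this
  have hs0 : 0 ≤ Real.sqrt x := Real.sqrt_nonneg x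
  have hsy0 : 0 ≤ Real.sqrt y := Real.sqrt_nonneg y
  have hxx : Real.sqrt x * Real.sqrt x = x := Real.mul_self_sqrt hx0
  have hsq : 2500 ≤ Real.sqrt x := by
    rw [show (2500 : ℝ) = Real.sqrt (2500 ^ 2) by rw [Real.sqrt_sq (by norm_num)]]
    exact Real.sqrt_le_sqrt (by nlinarith)
  rcases lt_or_ge y ((2 : ℝ) ^ 32) with h32 | h32
  · -- Nicolas's `ψ − θ ≤ √y + (4/3) y^{1/3}`
    have hE := psi_sub_theta_le_of_lt_two_pow_32 hy1 h32
    have hcube : y ^ ((1 : ℝ) / 3) ≤ Real.sqrt y := by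
      rw [Real.sqrt_eq_rpow]
      exact Real.rpow_le_rpow_of_exponent_le hy1 (by norm_num)
    nlinarith
  · -- Mathlib's `ψ − θ ≤ 2 √y log y`, `log y ≤ 14 + √y/1490`
    have hE := Chebyshev.psi_sub_theta_le hy1
    have hlog := log_le_sqrt_linear hy0
    have hlog0 : 0 ≤ Real.log y := Real.log_nonneg hy1
    have hyy : Real.sqrt y * Real.sqrt y = y := Real.mul_self_sqrt hy0.le
    -- `√y ≥ 2^16`
    have hsy : 65536 ≤ Real.sqrt y := by
      rw [show (65536 : ℝ) = Real.sqrt (65536 ^ 2) by rw [Real.sqrt_sq (by norm_num)]]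
      exact Real.sqrt_le_sqrt (by nlinarith)
    have hE' : ψ y - θ y ≤ 2 * Real.sqrt y * (14 + Real.sqrt y / 1490) := by
      calc ψ y - θ y ≤ 2 * Real.sqrt y * Real.log y := hE
        _ ≤ 2 * Real.sqrt y * (14 + Real.sqrt y / 1490) :=
            mul_le_mul_of_nonneg_left hlog (by positivity)
    nlinarith

/-! ### Many primes in `(x, 1.15x]` -/

/-- **`θ(1.15 x) − θ(x) ≥ x/200` for `x ≥ 10⁸`** (from the Sylvester bounds and the `ψ − θ`
bounds as in `window_large`). [cite: Sylvester1892, pp. 87–120 (scheme [1,6,70;2,3,5,7,210])] -/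
theorem theta_window_ge {x : ℝ} (hx : 100000000 ≤ x) : x / 200 ≤ θ (23 / 20 * x) - θ x := by
  have hx0 : 0 ≤ x := by linarith
  set y : ℝ := 23 / 20 * x with hy
  have hy1 : 1 ≤ y := by rw [hy]; linarith
  have hy0 : 0 < y := by linarith
  have hψx := psi_le_sylvester hx0
  have hψy := sylvester_le_psi (x := y) hy0.le
  have hθx := Chebyshev.theta_le_psi x
  have s2 : Real.sqrt y ≤ 1.0724 * Real.sqrt x := by
    have := sqrt_div_le (x := x) (r := 20 / 23) (c := 1.0724) hx0 (by norm_num) (by norm_num) (by norm_num)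
    rwa [show x / (20 / 23) = 23 / 20 * x by ring] at this
  have hs0 : 0 ≤ Real.sqrt x := Real.sqrt_nonneg x
  have hsy0 : 0 ≤ Real.sqrt y := Real.sqrt_nonneg y
  have hxx : Real.sqrt x * Real.sqrt x = x := Real.mul_self_sqrt hx0
  have hsq : 10000 ≤ Real.sqrt x := by
    rw [show (10000 : ℝ) = Real.sqrt (10000 ^ 2) by rw [Real.sqrt_sq (by norm_num)]]
    exact Real.sqrt_le_sqrt (by nlinarith)
  rcases lt_or_ge y ((2 : ℝ) ^ 32) with h32 | h32
  · have hE := psi_sub_theta_le_of_lt_two_pow_32 hy1 h32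
    have hcube : y ^ ((1 : ℝ) / 3) ≤ Real.sqrt y := by
      rw [Real.sqrt_eq_rpow]
      exact Real.rpow_le_rpow_of_exponent_le hy1 (by norm_num)
    nlinarith
  · have hE := Chebyshev.psi_sub_theta_le hy1
    have hlog := log_le_sqrt_linear hy0
    have hlog0 : 0 ≤ Real.log y := Real.log_nonneg hy1
    have hyy : Real.sqrt y * Real.sqrt y = y := Real.mul_self_sqrt hy0.le
    have hsy : 65536 ≤ Real.sqrt y := by
      rw [show (65536 : ℝ) = Real.sqrt (65536 ^ 2) by rw [Real.sqrt_sq (by norm_num)]]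
      exact Real.sqrt_le_sqrt (by nlinarith)
    have hE' : ψ y - θ y ≤ 2 * Real.sqrt y * (14 + Real.sqrt y / 1490) := by
      calc ψ y - θ y ≤ 2 * Real.sqrt y * Real.log y := hE
        _ ≤ 2 * Real.sqrt y * (14 + Real.sqrt y / 1490) :=
            mul_le_mul_of_nonneg_left hlog (by positivity)
    nlinarith

/-- `θ(b) − θ(a) ≤ #{primes in (a,b]} · log b` for `1 ≤ a ≤ b`. [folklore] -/
theorem theta_sub_theta_le_card_mul_log {a b : ℝ} (ha : 1 ≤ a) (hab : a ≤ b) :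
    θ b - θ a ≤ (((Ioc ⌊a⌋₊ ⌊b⌋₊).filter Nat.Prime).card : ℝ) * Real.log b := by
  rw [theta_sub_theta_eq_sum hab]
  have hb0 : 0 ≤ b := by linarith
  have : ∀ p ∈ (Ioc ⌊a⌋₊ ⌊b⌋₊).filter Nat.Prime, Real.log p ≤ Real.log b := by
    intro p hp
    simp only [Finset.mem_filter, Finset.mem_Ioc] at hp
    have hpb : (p : ℝ) ≤ b := (Nat.le_floor_iff hb0).1 hp.1.2
    exact Real.log_le_log (by exact_mod_cast hp.2.pos) hpb
  calc ∑ p ∈ (Ioc ⌊a⌋₊ ⌊b⌋₊).filter Nat.Prime, Real.log p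
      ≤ ∑ _p ∈ (Ioc ⌊a⌋₊ ⌊b⌋₊).filter Nat.Prime, Real.log b := Finset.sum_le_sum this
    _ = _ := by rw [Finset.sum_const, nsmul_eq_mul]

/-- **Many primes in `(x, 1.15x]`: at least `x/(200 log(1.15 x))` of them for `x ≥ 10⁸`** (the input
"`k³` primes in a window of ratio `η`" of Ford's Lemmas 3.2 and 6.5 once `x ≥ 200 k³ log(1.15x)`).
[cite: Sylvester1892, pp. 87–120 (scheme [1,6,70;2,3,5,7,210])] -/
theorem card_primes_window_ge {x : ℝ} (hx : 100000000 ≤ x) :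
    x / (200 * Real.log (23 / 20 * x)) ≤ (((Ioc ⌊x⌋₊ ⌊23 / 20 * x⌋₊).filter Nat.Prime).card : ℝ) := by
  have h1 := theta_window_ge hx
  have h2 := theta_sub_theta_le_card_mul_log (a := x) (b := 23 / 20 * x) (by linarith) (by linarith)
  have hlog : 0 < Real.log (23 / 20 * x) := Real.log_pos (by linarith)
  rw [div_le_iff₀ (by positivity)]
  nlinarith

end Sylvester

open scoped Chebyshev

/-- **Primes in `(x, 1.15 x]`: for every real `x ≥ 33` there is a prime `p` with
`x < p ≤ (23/20) x`.** Unconditional and explicit at all scales (Chebyshev–Sylvester slopes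
`0.9392`/`1.0722` beyond `6.25·10⁶`, kernel-certified tables below).
[cite: Sylvester1892, pp. 87–120 (scheme [1,6,70;2,3,5,7,210])] -/
theorem exists_prime_Ioc_sylvester {x : ℝ} (hx : 33 ≤ x) :
    ∃ p : ℕ, p.Prime ∧ x < p ∧ (p : ℝ) ≤ 23 / 20 * x := by
  rcases lt_or_ge x 27337 with h1 | h1
  · exact Sylvester.window_small hx h1
  rcases le_or_gt x 7000000 with h2 | h2
  · exact Sylvester.window_mid (by linarith) h2
  · exact Sylvester.window_large (by linarith)

/-- The same in the shape of the prime-window hypothesis of `FordVK.ford_lemma67`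
(`∀ x ≥ U, ∃ p prime, x ≤ p ≤ η x`) with `η = 23/20` and any `U ≥ 33`.
[cite: Sylvester1892, pp. 87–120 (scheme [1,6,70;2,3,5,7,210])] -/
theorem exists_prime_Icc_sylvester {U x : ℝ} (hU : 33 ≤ U) (hx : U ≤ x) :
    ∃ p : ℕ, p.Prime ∧ x ≤ p ∧ (p : ℝ) ≤ 23 / 20 * x := by
  obtain ⟨p, hp, h1, h2⟩ := exists_prime_Ioc_sylvester (x := x) (by linarith)
  exact ⟨p, hp, h1.le, h2⟩

end Literature.NumberTheory.LFunctions
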